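import Literature.MathematicalPhysics.QuantumFieldTheory.Balaban1983to89.B9Eq335ClassBridgePV1
import Literature.MathematicalPhysics.QuantumFieldTheory.Balaban1983to89.B9BackgroundsKLevelV1R
import Literature.MathematicalPhysics.QuantumFieldTheory.Balaban1983to89.B9PinGeometryKLevelV1B

/-!
# `Balaban1983to89.B9Eq3132RefinesYReadings` — T. Bałaban, *Propagators for lattice gauge theories in a background field*, Commun. Math. Phys. **99** (1985)
# 389–434 [Balaban1985BackgroundPropagators], (3.35)–(3.36) p. 396 («a number ≧ 10»): THE TWO READINGS OF THE CLASS-REFINEMENT HYPOTHESIS `hY` OF ROW 26's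
# R-GENERIC FACE (`B9Eq3132FacesAtLettersR.s3132Nu_opsYSectE_of_step12_R_of_refinesYPos`) — at MODULE 3's families (trivial) and at PRINT's CLASS
# (dag-n06-j's bridge `B9Eq335ClassBridgePV1`, ONE constant `c′ = 10·L⁴`)

statement-level skeleton of published theorems with citation tags; proofs where landed; nothing here is a claim about the Yang–Mills mass gap

THE PRINT.  [B9] p. 396: *«|U(∂p) − 1| ≦ O(1)(Lʲη)⁻²·Mα₀ … (3.35) … (3.36) … where O(1) is a number ≧ 10»* — the tree carries two readings of the cube class:
MODULE 3's per-cube-uniform class `(regY335, regY336)` at a constant `c` and MODULE 3-P's reading of print's open-ended class `(regYP335, regYP336)`; dag-n06-j's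
bridge (p. 396 + Thm 3.14 pp. 426–427): `regYP335 c α₀ ⇒ regY335 c′ α₀` for `c ≤ 10`, `0 ≤ α₀`, `c′ ≥ 10·L³`, and `regYP336 c α₀ ⇒ regY336 c′ α₀` for `c′ ≥ 10·L⁴`.

WHY THIS FILE (dag-n06-i gen 21, CASCADE-R STEP 2).  Row 26's R-generic knit face displays, besides `MemOfFam SU(N) R₁`, ONE class-content hypothesis
`hY : ∀ x α₀ U, 0 < α₀ → R₁ x c35 α₀ U → R₂ x c35 α₀ U → regY335 … x c′ α₀ U ∧ regY336 … x c′ α₀ U` («the carrier's class at `c35` refines MODULE 3's class at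
some `c′`», through which my g14 tent-energy estimate `hP1_of_reg335 θ M⋆ c′` is read).  This file packages its two inhabitants so that the R-edition's Y-closer
and P-closer are one name each: at `(R₁, R₂) := (regY335, regY336)` with `c′ = c35` (identity), and at `(regYP335, regYP336)` with `c35 ≤ 10` and `c′ = 10·L⁴`
(dag-n06-j's `regY335_of_regYP335` at `10·L³ ≤ 10·L⁴` and `regY336_of_regYP336`).

WHAT IS PROVED (sorry-free, 0 def, 3 thm; generic `𝔸`, `G`).
* `refinesY_regY (c)` — the Y-reading (identity).
* ★ `refinesY_regYP (hc : c ≤ 10)` — the P-reading with `c′ = 10·L⁴` (`10·L³ ≤ 10·L⁴` is def-Y's `B9PinGeometryKLevelV1B.ten_L3_le_ten_L4`), ★ `refinesY_regYP_c35Y` — at MODULE 4's letter `c35Y = 10`.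

HONEST SCOPE.  Two-line compositions of dag-n06-j's landed bridge; nothing of [B9] asserted beyond it; count-neutral; N06 NOT discharged; one finite 𝕋^{d+1}
programme at fixed ε — nothing continuum, nothing OS, nothing about the mass gap.  Cell `pub-ymgap` (HUMAN RULING D-0062), Track A node N06 [B9], seat
`pub-ymgap-dag-n06-i` (gen 21), 2026-08-28; a NEW file.
-/

noncomputable section

namespace Literature.MathematicalPhysics.QuantumFieldTheory.Balaban1983to89.B9Eq3132RefinesYReadings

open B6KLevelCensusIndexV1 (KIdx)
open B9BackgroundsKLevelV1 (CfgV1)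
open B6GlobalChartV1 (PV)
open B9PinMembersKLevelV1 (MemberY geo9Y bg9Y)
open B9PinGeometryKLevelV1 (c35Y)
open B9PinGeometryKLevelV1B (ten_L3_le_ten_L4)
open B9BackgroundsKLevelV1R (RegFamY bg9YR regY335 regY336 regYP335 regYP336)
open B9Eq335ClassBridgePV1 (regY335_of_regYP335 regY336_of_regYP336)

variable {d ℓ : ℕ} {hd : 1 ≤ d + 1} {hL : Odd (ℓ + 1) ∧ 1 < ℓ + 1} {b₀ b₁ : ℝ} {Mstar : ℕ}
variable {𝔸 : Type} [NormedRing 𝔸] [NormedAlgebra ℂ 𝔸] [CompleteSpace 𝔸] {G : Subgroup 𝔸ˣ}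

/-- **THE Y-READING OF `hY`**: at MODULE 3's families the refinement is the identity (`c′ = c`).
[cite: Balaban1985BackgroundPropagators, (3.35)–(3.36) p.396 (bookkeeping: the class read at itself)] -/
theorem refinesY_regY (c : ℝ) :
    ∀ (x : MemberY d ℓ hd hL b₀ b₁ Mstar) (α₀ : ℝ) (U : CfgV1 (PV d ℓ x.m x.K hd hL) 𝔸), 0 < α₀ →
      regY335 𝔸 G x c α₀ U → regY336 𝔸 G x c α₀ U → regY335 𝔸 G x c α₀ U ∧ regY336 𝔸 G x c α₀ U :=
  fun _ _ _ _ h h' => ⟨h, h'⟩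

/-- ★ **THE P-READING OF `hY`**: at print's class `(regYP335, regYP336)` with threshold `c ≤ 10`, the refinement of MODULE 3's class holds with ONE constant
`c′ = 10·L⁴` — dag-n06-j's `regY335_of_regYP335` (at `10·L³ ≤ 10·L⁴`) and `regY336_of_regYP336`; the `0 < α₀` guard supplies their `0 ≤ α₀`.
[cite: Balaban1985BackgroundPropagators, (3.35)–(3.36) p.396 («a number ≧ 10»), Thm 3.14 pp.426–427] -/
theorem refinesY_regYP {c : ℝ} (hc : c ≤ 10) :
    ∀ (x : MemberY d ℓ hd hL b₀ b₁ Mstar) (α₀ : ℝ) (U : CfgV1 (PV d ℓ x.m x.K hd hL) 𝔸), 0 < α₀ →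
      regYP335 𝔸 G x c α₀ U → regYP336 𝔸 G x c α₀ U →
        regY335 𝔸 G x (10 * ((ℓ + 1 : ℕ) : ℝ) ^ 4) α₀ U ∧ regY336 𝔸 G x (10 * ((ℓ + 1 : ℕ) : ℝ) ^ 4) α₀ U :=
  fun x _ _ hα h h' => ⟨regY335_of_regYP335 x hc hα.le h (ten_L3_le_ten_L4 ℓ), regY336_of_regYP336 x hc hα.le h' le_rfl⟩

/-- ★ **THE P-READING AT MODULE 4's LETTER `c35Y = 10`** (the `carriersYR` pin `c35 := c35Y`): `hY` for the R-edition's P-closer, `c′ = 10·L⁴`.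
[cite: Balaban1985BackgroundPropagators, (3.35)–(3.36) p.396 («a number ≧ 10»)] -/
theorem refinesY_regYP_c35Y :
    ∀ (x : MemberY d ℓ hd hL b₀ b₁ Mstar) (α₀ : ℝ) (U : CfgV1 (PV d ℓ x.m x.K hd hL) 𝔸), 0 < α₀ →
      regYP335 𝔸 G x c35Y α₀ U → regYP336 𝔸 G x c35Y α₀ U →
        regY335 𝔸 G x (10 * ((ℓ + 1 : ℕ) : ℝ) ^ 4) α₀ U ∧ regY336 𝔸 G x (10 * ((ℓ + 1 : ℕ) : ℝ) ^ 4) α₀ U :=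
  refinesY_regYP (by norm_num [c35Y])

end Literature.MathematicalPhysics.QuantumFieldTheory.Balaban1983to89.B9Eq3132RefinesYReadings

end
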